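import Summits.QuantumFields.YangMills.Theorems.FluctuationComparisonRegPrIntLOrganTangentJunctionDirectTransportCore
import Literature.MathematicalPhysics.QuantumFieldTheory.Balaban1983to89.T4WilsonLinkAffine
import Literature.MathematicalPhysics.QuantumFieldTheory.Balaban1983to89.B3Taylor310LocalRemainder
import Literature.MathematicalPhysics.QuantumFieldTheory.Balaban1983to89.B15Prop1JointHolomorphyFromBackground
import Summits.QuantumFields.YangMills.Theorems.UnitScaleGibbsLinProxySU2Letters
import HarnessLib

/-!
# Crux `FluctuationComparisonRegPrIntL` (stmt-QuantumFields-20520, rung R3), PATH-B organ, v18 (H-currency): tool brick (MH), PART 1 —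
# THE LETTERS OF `U(∂p)` UNDER TWO ONE-BOND MOVES: `|Re tr ΔΔ U(∂p)|∕2 ≤ 𝟙[b, b′ ∈ ∂p]·dist1(e^{v})·dist1(e^{v′})`

Cell `ym3-torus` (YM ladder rung R3 = continuum `SU(2)` Yang–Mills on the three-torus — a RUNG: NOT d = 4, NOT infinite volume, NOT a mass gap,
NOT Clay).  Width seat `ym3-torus-px8` (gen 20), LEAD `ym-ust-20520-w3` g25 WORD №3 tool brick **(MH)** «THE MARGINAL IS H-PRESENTABLE» (named
seat px13 g21 took its own S2β pen; fallback w5 g22 handed the pen on with the plan `MH-PLAN-w5g22.md`, which PART 1 ∕ PART 2 execute);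
`--kind proof --supports stmt-QuantumFields-20520 --as helper`, count-neutral, DEFINITION-FREE, default heartbeats, `autoImplicit false`; registry
`Lines/semiclassical_s2beta.lean` and `Lines/runpair_organ.lean` untouched.  Two files for the 400-line rule: this PART 1 (the per-plaquette bilinear
bound) and PART 2 `…OrganTangentMarginalHClause` (the clause `HClauseSq θ r k_W` for the marginal and the row-mass of `k_W`).

WHAT THIS IS (the only real work of (MH)).  Per plaquette, the EXACT bilinear structure of `U(∂p) = U(b₁)U(b₂)U(b₃)⁻¹U(b₄)⁻¹`
(lit ✓`T4WilsonLinkAffine.plaqHol_eq_letters`, `rfl`) in its four pairwise distinct letters (lit ✓`letters_pairwise_ne`) under the three one-bond moves of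
the organ's pair clause (`U → V` at `b` by a right factor `E`; `U → W` and `V → Z` at `b′` by `E′`): a move changes at most ONE letter, by a right factor
(positions 1, 2) or — inverted letters — a left factor (positions 3, 4), so the matrix second difference `Π(Z) − Π(V) − Π(W) + Π(U)` is a sum of words
with two letter-DIFFERENCES inserted (`b ≠ b′`) or one letter SECOND difference `U_b(E − 1)(E′ − 1)` (`b = b′`), all other letters unitary:
★★ `abs_secondDiff_reTr_plaqHol_le` — `|reTr Z(∂p) − reTr V(∂p) − reTr W(∂p) + reTr U(∂p)| ≤ 𝟙[IsLetter b p ∧ IsLetter b′ p]·dist1 E·dist1 E′`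
(zero hypotheses on the fields).  The bookkeeping is done ONCE for an abstract seminormed ring (§2 `profile_mul`, `word4_secondDiff_le`: the «profile»
(norms `≤ 1`, first differences along the two moves, second difference) is sub-additive under products), ONCE per letter map (§3 `letterProfile`,
instantiated at `g ↦ ↑g` and `g ↦ ↑g⁻¹`), and the supports are collapsed by `support_bookkeeping` (at most one position carries `b`, at most one `b′`);
§1 is the `2 × 2` toolkit over the tree's lemmas BY NAME (✓`UnitScaleGibbsLinProxySU2Letters.abs_re_trace_le_two_mul_norm` `|Re tr N| ≤ 2‖N‖_{op}`,
lit ✓`B15Prop1JointHolomorphyFromBackground.reTr_eq_trace_re` `reTr = Re tr∕2`, lit ✓`T4ExpWindowSmallField.dist1_eq_norm_coe_sub_one` `dist1 = ‖· − 1‖_{op}`).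

HONEST FRAMING: lattice ∕ `2 × 2`-matrix bookkeeping [folklore]; nothing of Bałaban's analysis is asserted or proved; LINᵘ-H ∕ JENᵘ-H ∕ O1ᵘ-H v2
(XL, the crux of the crux), S1aᴴ, S2α′, S2β, the five registered ∘-stubs OPEN; crux 20520 `FluctuationComparisonRegPrIntL` ∕ `YM3TorusSU2` NOT proved;
no summit ∕ sub-problem statement is proved by a helper; rung R3 = SU(2) YM₃ on T³ at fixed lattice data — NOT d = 4, NOT infinite volume, NOT a mass gap,
NOT Clay; the Yang–Mills mass gap is NOT proved.  LOCATE: the Wilson action's link structure = T. Bałaban, CMP **102** (1985) 277–309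
[Balaban1985Variational] (30)–(33) pp.282–283 (the second-order expansion of the plaquette action with quartic remainder; shape only, nothing cited as a fact — lit g31 PENS NOTE 03:23:48Z page check); tree: lit `T4WilsonLinkAffine` (one-link AFFINE structure, first order) —
this file is its second-order, two-link companion.
-/

set_option autoImplicit false

noncomputable section

open scoped BigOperators Matrix.Norms.L2Operator
open Literature.MathematicalPhysics.QuantumFieldTheory.Balaban1983to89
open Literature.MathematicalPhysics.QuantumLattice (fundamentalRep fundamentalRep_apply)
open T4CubeChartGnomonic (SU2)
open T4WilsonLinkAffine (bond₁ bond₂ bond₃ bond₄ IsLetter plaqHol_eq_letters letters_pairwise_ne)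
open T4ExpWindowSmallField (dist1_eq_norm_coe_sub_one)
open B15Prop1JointHolomorphyFromBackground (reTr_eq_trace_re)
open Summit.QuantumFields.YangMills.Theorems.UnitScaleGibbsLinProxySU2Letters (abs_re_trace_le_two_mul_norm)

namespace Summit.QuantumFields.YangMills.Theorems.OrganTangentMarginalHClauseLetters

/-! ## §1  `2 × 2` matrix toolkit (L²-operator norm; `|Re tr N| ≤ 2‖N‖`, `reTr = Re tr∕2`, `dist1 = ‖· − 1‖` are the tree's, imported BY NAME) -/

section MatrixToolkit

/-- An `SU(2)` matrix has operator norm `≤ 1`. [folklore] -/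
theorem norm_coe_le_one (g : SU2) : ‖(g : Matrix (Fin 2) (Fin 2) ℂ)‖ ≤ 1 :=
  (UnitaryModel.norm_of_mem_unitaryGroup g.2.1).le

/-- `|reTr Z − reTr V − reTr W + reTr U| ≤ ‖↑Z − ↑V − ↑W + ↑U‖_{op}` on `SU(2)`. [folklore] -/
theorem abs_secondDiff_reTr_le_norm (U V W Z : SU2) :
    |reTr Z - reTr V - reTr W + reTr U| ≤
      ‖(Z : Matrix (Fin 2) (Fin 2) ℂ) - (V : Matrix (Fin 2) (Fin 2) ℂ) - (W : Matrix (Fin 2) (Fin 2) ℂ) + (U : Matrix (Fin 2) (Fin 2) ℂ)‖ := by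
  simp only [reTr_eq_trace_re]
  have h := abs_re_trace_le_two_mul_norm
    ((Z : Matrix (Fin 2) (Fin 2) ℂ) - (V : Matrix (Fin 2) (Fin 2) ℂ) - (W : Matrix (Fin 2) (Fin 2) ℂ) + (U : Matrix (Fin 2) (Fin 2) ℂ))
  simp only [Matrix.trace_add, Matrix.trace_sub, Complex.add_re, Complex.sub_re] at h
  rw [show ((Z : Matrix (Fin 2) (Fin 2) ℂ).trace.re / 2 - (V : Matrix (Fin 2) (Fin 2) ℂ).trace.re / 2 -
      (W : Matrix (Fin 2) (Fin 2) ℂ).trace.re / 2 + (U : Matrix (Fin 2) (Fin 2) ℂ).trace.re / 2) =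
      ((Z : Matrix (Fin 2) (Fin 2) ℂ).trace.re - (V : Matrix (Fin 2) (Fin 2) ℂ).trace.re -
        (W : Matrix (Fin 2) (Fin 2) ℂ).trace.re + (U : Matrix (Fin 2) (Fin 2) ℂ).trace.re) / 2 by ring, abs_div,
    abs_of_pos (by norm_num : (0:ℝ) < 2)]
  linarith

end MatrixToolkit

/-! ## §2  Profiles of first ∕ second differences are sub-additive under products (abstract seminormed ring) -/

section Abstract

variable {M : Type*} [SeminormedRing M]

/-- `‖X‖, ‖Y‖ ≤ 1 ⇒ ‖XY‖ ≤ 1`. [folklore] -/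
theorem norm_mul_le_one_of_le {X Y : M} (hX : ‖X‖ ≤ 1) (hY : ‖Y‖ ≤ 1) : ‖X * Y‖ ≤ 1 :=
  (norm_mul_le X Y).trans (mul_le_one₀ hX (norm_nonneg _) hY)

/-- First differences of a product: `‖X′Y′ − XY‖ ≤ a + a′` if `‖X′ − X‖ ≤ a`, `‖Y′ − Y‖ ≤ a′`, `‖X‖, ‖Y′‖ ≤ 1`
(`X′Y′ − XY = (X′ − X)Y′ + X(Y′ − Y)`). [folklore] -/
theorem norm_mul_sub_mul_le {X X' Y Y' : M} {a a' : ℝ} (hX : ‖X‖ ≤ 1) (hY' : ‖Y'‖ ≤ 1)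
    (h1 : ‖X' - X‖ ≤ a) (h2 : ‖Y' - Y‖ ≤ a') : ‖X' * Y' - X * Y‖ ≤ a + a' := by
  have e : X' * Y' - X * Y = (X' - X) * Y' + X * (Y' - Y) := by noncomm_ring
  rw [e]
  have ha : 0 ≤ a := (norm_nonneg _).trans h1
  calc ‖(X' - X) * Y' + X * (Y' - Y)‖ ≤ ‖(X' - X) * Y'‖ + ‖X * (Y' - Y)‖ := norm_add_le _ _
    _ ≤ ‖X' - X‖ * ‖Y'‖ + ‖X‖ * ‖Y' - Y‖ := add_le_add (norm_mul_le _ _) (norm_mul_le _ _)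
    _ ≤ a * 1 + 1 * a' :=
        add_le_add (mul_le_mul h1 hY' (norm_nonneg _) ha) (mul_le_mul hX h2 (norm_nonneg _) zero_le_one)
    _ = a + a' := by ring

/-- Second differences of a product:
`ΔΔ(XY) = ΔΔX·Y_z + X_w·ΔΔY + (X_v − X_u)(Y_z − Y_v) + (X_w − X_u)(Y_v − Y_u)`, hence
`‖ΔΔ(XY)‖ ≤ c + c′ + (a·b′ + b·a′)`. [folklore] -/
theorem norm_secondDiff_mul_le {Xu Xv Xw Xz Yu Yv Yw Yz : M} {a b c a' b' c' : ℝ}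
    (hXw : ‖Xw‖ ≤ 1) (hYz : ‖Yz‖ ≤ 1)
    (hXvu : ‖Xv - Xu‖ ≤ a) (hXwu : ‖Xw - Xu‖ ≤ b) (hXc : ‖Xz - Xv - Xw + Xu‖ ≤ c)
    (hYvu : ‖Yv - Yu‖ ≤ a') (hYzv : ‖Yz - Yv‖ ≤ b') (hYc : ‖Yz - Yv - Yw + Yu‖ ≤ c') :
    ‖Xz * Yz - Xv * Yv - Xw * Yw + Xu * Yu‖ ≤ c + c' + (a * b' + b * a') := by
  have e : Xz * Yz - Xv * Yv - Xw * Yw + Xu * Yu =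
      (Xz - Xv - Xw + Xu) * Yz + Xw * (Yz - Yv - Yw + Yu) + (Xv - Xu) * (Yz - Yv) + (Xw - Xu) * (Yv - Yu) := by
    noncomm_ring
  rw [e]
  have ha : 0 ≤ a := (norm_nonneg _).trans hXvu
  have hb : 0 ≤ b := (norm_nonneg _).trans hXwu
  have hc : 0 ≤ c := (norm_nonneg _).trans hXc
  calc ‖(Xz - Xv - Xw + Xu) * Yz + Xw * (Yz - Yv - Yw + Yu) + (Xv - Xu) * (Yz - Yv) + (Xw - Xu) * (Yv - Yu)‖
      ≤ ‖(Xz - Xv - Xw + Xu) * Yz‖ + ‖Xw * (Yz - Yv - Yw + Yu)‖ + ‖(Xv - Xu) * (Yz - Yv)‖ + ‖(Xw - Xu) * (Yv - Yu)‖ := by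
        refine (norm_add_le _ _).trans (add_le_add ((norm_add_le _ _).trans (add_le_add (norm_add_le _ _) le_rfl)) le_rfl)
    _ ≤ ‖Xz - Xv - Xw + Xu‖ * ‖Yz‖ + ‖Xw‖ * ‖Yz - Yv - Yw + Yu‖ + ‖Xv - Xu‖ * ‖Yz - Yv‖ + ‖Xw - Xu‖ * ‖Yv - Yu‖ := by
        gcongr <;> exact norm_mul_le _ _
    _ ≤ c * 1 + 1 * c' + a * b' + b * a' := by
        gcongr
    _ = c + c' + (a * b' + b * a') := by ring

/-- The PROFILE of a product: norms `≤ 1`, first differences along the two moves `≤ a + a′` resp. `≤ b + b′`, second difference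
`≤ c + c′ + (a·b′ + b·a′)`. [folklore] -/
theorem profile_mul {Xu Xv Xw Xz Yu Yv Yw Yz : M} {a b c a' b' c' : ℝ}
    (hX : ‖Xu‖ ≤ 1 ∧ ‖Xv‖ ≤ 1 ∧ ‖Xw‖ ≤ 1 ∧ ‖Xz‖ ≤ 1 ∧ ‖Xv - Xu‖ ≤ a ∧ ‖Xz - Xw‖ ≤ a ∧ ‖Xw - Xu‖ ≤ b ∧ ‖Xz - Xv‖ ≤ b ∧
      ‖Xz - Xv - Xw + Xu‖ ≤ c)
    (hY : ‖Yu‖ ≤ 1 ∧ ‖Yv‖ ≤ 1 ∧ ‖Yw‖ ≤ 1 ∧ ‖Yz‖ ≤ 1 ∧ ‖Yv - Yu‖ ≤ a' ∧ ‖Yz - Yw‖ ≤ a' ∧ ‖Yw - Yu‖ ≤ b' ∧ ‖Yz - Yv‖ ≤ b' ∧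
      ‖Yz - Yv - Yw + Yu‖ ≤ c') :
    ‖Xu * Yu‖ ≤ 1 ∧ ‖Xv * Yv‖ ≤ 1 ∧ ‖Xw * Yw‖ ≤ 1 ∧ ‖Xz * Yz‖ ≤ 1 ∧
    ‖Xv * Yv - Xu * Yu‖ ≤ a + a' ∧ ‖Xz * Yz - Xw * Yw‖ ≤ a + a' ∧
    ‖Xw * Yw - Xu * Yu‖ ≤ b + b' ∧ ‖Xz * Yz - Xv * Yv‖ ≤ b + b' ∧
    ‖Xz * Yz - Xv * Yv - Xw * Yw + Xu * Yu‖ ≤ c + c' + (a * b' + b * a') := by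
  obtain ⟨hXu, hXv, hXw, hXz, hXvu, hXzw, hXwu, hXzv, hXc⟩ := hX
  obtain ⟨hYu, hYv, hYw, hYz, hYvu, hYzw, hYwu, hYzv, hYc⟩ := hY
  exact ⟨norm_mul_le_one_of_le hXu hYu, norm_mul_le_one_of_le hXv hYv, norm_mul_le_one_of_le hXw hYw,
    norm_mul_le_one_of_le hXz hYz, norm_mul_sub_mul_le hXu hYv hXvu hYvu, norm_mul_sub_mul_le hXw hYz hXzw hYzw,
    norm_mul_sub_mul_le hXu hYw hXwu hYwu, norm_mul_sub_mul_le hXv hYz hXzv hYzv,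
    norm_secondDiff_mul_le hXw hYz hXvu hXwu hXc hYvu hYzv hYc⟩

/-- ★ THE FOUR-LETTER WORD: if letter `k ∈ {0,1,2,3}` has profile `(aₖ, bₖ, cₖ)` at the four corners `u, v, w, z`, the second difference
of the word `x₀x₁x₂x₃` is `≤ Σ cₖ + Σ_{k<l} (aₖ b_l + bₖ a_l)`. [folklore] -/
theorem word4_secondDiff_le {u₀ u₁ u₂ u₃ v₀ v₁ v₂ v₃ w₀ w₁ w₂ w₃ z₀ z₁ z₂ z₃ : M}
    {a₀ a₁ a₂ a₃ b₀ b₁ b₂ b₃ c₀ c₁ c₂ c₃ : ℝ}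
    (h₀ : ‖u₀‖ ≤ 1 ∧ ‖v₀‖ ≤ 1 ∧ ‖w₀‖ ≤ 1 ∧ ‖z₀‖ ≤ 1 ∧ ‖v₀ - u₀‖ ≤ a₀ ∧ ‖z₀ - w₀‖ ≤ a₀ ∧ ‖w₀ - u₀‖ ≤ b₀ ∧ ‖z₀ - v₀‖ ≤ b₀ ∧
      ‖z₀ - v₀ - w₀ + u₀‖ ≤ c₀)
    (h₁ : ‖u₁‖ ≤ 1 ∧ ‖v₁‖ ≤ 1 ∧ ‖w₁‖ ≤ 1 ∧ ‖z₁‖ ≤ 1 ∧ ‖v₁ - u₁‖ ≤ a₁ ∧ ‖z₁ - w₁‖ ≤ a₁ ∧ ‖w₁ - u₁‖ ≤ b₁ ∧ ‖z₁ - v₁‖ ≤ b₁ ∧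
      ‖z₁ - v₁ - w₁ + u₁‖ ≤ c₁)
    (h₂ : ‖u₂‖ ≤ 1 ∧ ‖v₂‖ ≤ 1 ∧ ‖w₂‖ ≤ 1 ∧ ‖z₂‖ ≤ 1 ∧ ‖v₂ - u₂‖ ≤ a₂ ∧ ‖z₂ - w₂‖ ≤ a₂ ∧ ‖w₂ - u₂‖ ≤ b₂ ∧ ‖z₂ - v₂‖ ≤ b₂ ∧
      ‖z₂ - v₂ - w₂ + u₂‖ ≤ c₂)
    (h₃ : ‖u₃‖ ≤ 1 ∧ ‖v₃‖ ≤ 1 ∧ ‖w₃‖ ≤ 1 ∧ ‖z₃‖ ≤ 1 ∧ ‖v₃ - u₃‖ ≤ a₃ ∧ ‖z₃ - w₃‖ ≤ a₃ ∧ ‖w₃ - u₃‖ ≤ b₃ ∧ ‖z₃ - v₃‖ ≤ b₃ ∧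
      ‖z₃ - v₃ - w₃ + u₃‖ ≤ c₃) :
    ‖z₀ * z₁ * z₂ * z₃ - v₀ * v₁ * v₂ * v₃ - w₀ * w₁ * w₂ * w₃ + u₀ * u₁ * u₂ * u₃‖ ≤
      (c₀ + c₁ + c₂ + c₃) + (a₀ * (b₁ + b₂ + b₃) + a₁ * (b₂ + b₃) + a₂ * b₃) +
        (b₀ * (a₁ + a₂ + a₃) + b₁ * (a₂ + a₃) + b₂ * a₃) := by
  have h01 := profile_mul h₀ h₁
  have h012 := profile_mul h01 h₂
  have h0123 := profile_mul h012 h₃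
  refine h0123.2.2.2.2.2.2.2.2.trans (le_of_eq ?_)
  ring

end Abstract

/-! ## §3  The letters of `U(∂p)` under one-bond moves -/

section Letters

variable {P : Params} {j : ℕ}

/-- Position-type 1, 2: a right move by `E` changes the letter by `≤ dist1 E`. [folklore] -/
theorem coe_move_le (g E : SU2) : ‖((g * E : SU2) : Matrix (Fin 2) (Fin 2) ℂ) - (g : Matrix (Fin 2) (Fin 2) ℂ)‖ ≤ dist1 E := by
  rw [Submonoid.coe_mul, show (g : Matrix (Fin 2) (Fin 2) ℂ) * (E : Matrix (Fin 2) (Fin 2) ℂ) - g = g * ((E : Matrix (Fin 2) (Fin 2) ℂ) - 1) by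
    rw [mul_sub, mul_one], dist1_eq_norm_coe_sub_one]
  exact (norm_mul_le _ _).trans (by nlinarith [norm_coe_le_one g, norm_nonneg ((E : Matrix (Fin 2) (Fin 2) ℂ) - 1)])

/-- Position-type 1, 2: `↑(gEE′) − ↑(gE′) = ↑g(↑E − 1)↑E′` has norm `≤ dist1 E`. [folklore] -/
theorem coe_move_mid_le (g E E' : SU2) :
    ‖((g * E * E' : SU2) : Matrix (Fin 2) (Fin 2) ℂ) - ((g * E' : SU2) : Matrix (Fin 2) (Fin 2) ℂ)‖ ≤ dist1 E := by
  have e : ((g * E * E' : SU2) : Matrix (Fin 2) (Fin 2) ℂ) - ((g * E' : SU2) : Matrix (Fin 2) (Fin 2) ℂ) =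
      (g : Matrix (Fin 2) (Fin 2) ℂ) * ((E : Matrix (Fin 2) (Fin 2) ℂ) - 1) * (E' : Matrix (Fin 2) (Fin 2) ℂ) := by
    simp only [Submonoid.coe_mul]; noncomm_ring
  rw [e, dist1_eq_norm_coe_sub_one]
  calc ‖(g : Matrix (Fin 2) (Fin 2) ℂ) * ((E : Matrix (Fin 2) (Fin 2) ℂ) - 1) * (E' : Matrix (Fin 2) (Fin 2) ℂ)‖
      ≤ ‖(g : Matrix (Fin 2) (Fin 2) ℂ)‖ * ‖(E : Matrix (Fin 2) (Fin 2) ℂ) - 1‖ * ‖(E' : Matrix (Fin 2) (Fin 2) ℂ)‖ :=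
        (norm_mul_le _ _).trans (mul_le_mul_of_nonneg_right (norm_mul_le _ _) (norm_nonneg _))
    _ ≤ 1 * ‖(E : Matrix (Fin 2) (Fin 2) ℂ) - 1‖ * 1 :=
        mul_le_mul (mul_le_mul_of_nonneg_right (norm_coe_le_one g) (norm_nonneg _)) (norm_coe_le_one E')
          (norm_nonneg _) (mul_nonneg zero_le_one (norm_nonneg _))
    _ = ‖(E : Matrix (Fin 2) (Fin 2) ℂ) - 1‖ := by ring

/-- Position-type 1, 2: the letter's own second difference `↑g(↑E − 1)(↑E′ − 1)` has norm `≤ dist1 E·dist1 E′`. [folklore] -/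
theorem coe_move_two_le (g E E' : SU2) :
    ‖((g * E * E' : SU2) : Matrix (Fin 2) (Fin 2) ℂ) - ((g * E : SU2) : Matrix (Fin 2) (Fin 2) ℂ) -
        ((g * E' : SU2) : Matrix (Fin 2) (Fin 2) ℂ) + (g : Matrix (Fin 2) (Fin 2) ℂ)‖ ≤ dist1 E * dist1 E' := by
  have e : ((g * E * E' : SU2) : Matrix (Fin 2) (Fin 2) ℂ) - ((g * E : SU2) : Matrix (Fin 2) (Fin 2) ℂ) -
        ((g * E' : SU2) : Matrix (Fin 2) (Fin 2) ℂ) + (g : Matrix (Fin 2) (Fin 2) ℂ) =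
      (g : Matrix (Fin 2) (Fin 2) ℂ) * (((E : Matrix (Fin 2) (Fin 2) ℂ) - 1) * ((E' : Matrix (Fin 2) (Fin 2) ℂ) - 1)) := by
    simp only [Submonoid.coe_mul]; noncomm_ring
  rw [e, dist1_eq_norm_coe_sub_one, dist1_eq_norm_coe_sub_one]
  calc ‖(g : Matrix (Fin 2) (Fin 2) ℂ) * (((E : Matrix (Fin 2) (Fin 2) ℂ) - 1) * ((E' : Matrix (Fin 2) (Fin 2) ℂ) - 1))‖
      ≤ ‖(g : Matrix (Fin 2) (Fin 2) ℂ)‖ * (‖(E : Matrix (Fin 2) (Fin 2) ℂ) - 1‖ * ‖(E' : Matrix (Fin 2) (Fin 2) ℂ) - 1‖) :=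
        (norm_mul_le _ _).trans (mul_le_mul_of_nonneg_left (norm_mul_le _ _) (norm_nonneg _))
    _ ≤ 1 * (‖(E : Matrix (Fin 2) (Fin 2) ℂ) - 1‖ * ‖(E' : Matrix (Fin 2) (Fin 2) ℂ) - 1‖) :=
        mul_le_mul_of_nonneg_right (norm_coe_le_one g) (mul_nonneg (norm_nonneg _) (norm_nonneg _))
    _ = _ := one_mul _

/-- Position-type 3, 4 (`g ↦ ↑g⁻¹`): a right move by `E` changes the inverted letter by `≤ dist1 E` (`(gE)⁻¹ − g⁻¹ = (E⁻¹ − 1)g⁻¹`). [folklore] -/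
theorem inv_move_le (g E : SU2) :
    ‖(((g * E)⁻¹ : SU2) : Matrix (Fin 2) (Fin 2) ℂ) - ((g⁻¹ : SU2) : Matrix (Fin 2) (Fin 2) ℂ)‖ ≤ dist1 E := by
  have e : (((g * E)⁻¹ : SU2) : Matrix (Fin 2) (Fin 2) ℂ) - ((g⁻¹ : SU2) : Matrix (Fin 2) (Fin 2) ℂ) =
      ((((E⁻¹ : SU2)) : Matrix (Fin 2) (Fin 2) ℂ) - 1) * ((g⁻¹ : SU2) : Matrix (Fin 2) (Fin 2) ℂ) := by
    rw [mul_inv_rev, Submonoid.coe_mul]; noncomm_ring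
  rw [e, ← GaugeGroup.dist1_inv E, dist1_eq_norm_coe_sub_one]
  calc ‖((((E⁻¹ : SU2)) : Matrix (Fin 2) (Fin 2) ℂ) - 1) * ((g⁻¹ : SU2) : Matrix (Fin 2) (Fin 2) ℂ)‖
      ≤ ‖(((E⁻¹ : SU2)) : Matrix (Fin 2) (Fin 2) ℂ) - 1‖ * ‖((g⁻¹ : SU2) : Matrix (Fin 2) (Fin 2) ℂ)‖ := norm_mul_le _ _
    _ ≤ ‖(((E⁻¹ : SU2)) : Matrix (Fin 2) (Fin 2) ℂ) - 1‖ * 1 :=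
        mul_le_mul_of_nonneg_left (norm_coe_le_one _) (norm_nonneg _)
    _ = _ := mul_one _

/-- Position-type 3, 4: `(gEE′)⁻¹ − (gE′)⁻¹ = E′⁻¹(E⁻¹ − 1)g⁻¹` has norm `≤ dist1 E`. [folklore] -/
theorem inv_move_mid_le (g E E' : SU2) :
    ‖(((g * E * E')⁻¹ : SU2) : Matrix (Fin 2) (Fin 2) ℂ) - (((g * E')⁻¹ : SU2) : Matrix (Fin 2) (Fin 2) ℂ)‖ ≤ dist1 E := by
  have e : (((g * E * E')⁻¹ : SU2) : Matrix (Fin 2) (Fin 2) ℂ) - (((g * E')⁻¹ : SU2) : Matrix (Fin 2) (Fin 2) ℂ) =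
      ((E'⁻¹ : SU2) : Matrix (Fin 2) (Fin 2) ℂ) * ((((E⁻¹ : SU2)) : Matrix (Fin 2) (Fin 2) ℂ) - 1) *
        ((g⁻¹ : SU2) : Matrix (Fin 2) (Fin 2) ℂ) := by
    simp only [mul_inv_rev, Submonoid.coe_mul]; noncomm_ring
  rw [e, ← GaugeGroup.dist1_inv E, dist1_eq_norm_coe_sub_one]
  calc ‖((E'⁻¹ : SU2) : Matrix (Fin 2) (Fin 2) ℂ) * ((((E⁻¹ : SU2)) : Matrix (Fin 2) (Fin 2) ℂ) - 1) * ((g⁻¹ : SU2) : Matrix (Fin 2) (Fin 2) ℂ)‖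
      ≤ ‖((E'⁻¹ : SU2) : Matrix (Fin 2) (Fin 2) ℂ)‖ * ‖(((E⁻¹ : SU2)) : Matrix (Fin 2) (Fin 2) ℂ) - 1‖ *
          ‖((g⁻¹ : SU2) : Matrix (Fin 2) (Fin 2) ℂ)‖ :=
        (norm_mul_le _ _).trans (mul_le_mul_of_nonneg_right (norm_mul_le _ _) (norm_nonneg _))
    _ ≤ 1 * ‖(((E⁻¹ : SU2)) : Matrix (Fin 2) (Fin 2) ℂ) - 1‖ * 1 :=
        mul_le_mul (mul_le_mul_of_nonneg_right (norm_coe_le_one _) (norm_nonneg _)) (norm_coe_le_one _)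
          (norm_nonneg _) (mul_nonneg zero_le_one (norm_nonneg _))
    _ = _ := by ring

/-- Position-type 3, 4: the inverted letter's own second difference `(E′⁻¹ − 1)(E⁻¹ − 1)g⁻¹` has norm `≤ dist1 E·dist1 E′`. [folklore] -/
theorem inv_move_two_le (g E E' : SU2) :
    ‖(((g * E * E')⁻¹ : SU2) : Matrix (Fin 2) (Fin 2) ℂ) - (((g * E)⁻¹ : SU2) : Matrix (Fin 2) (Fin 2) ℂ) -
        (((g * E')⁻¹ : SU2) : Matrix (Fin 2) (Fin 2) ℂ) + ((g⁻¹ : SU2) : Matrix (Fin 2) (Fin 2) ℂ)‖ ≤ dist1 E * dist1 E' := by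
  have e : (((g * E * E')⁻¹ : SU2) : Matrix (Fin 2) (Fin 2) ℂ) - (((g * E)⁻¹ : SU2) : Matrix (Fin 2) (Fin 2) ℂ) -
        (((g * E')⁻¹ : SU2) : Matrix (Fin 2) (Fin 2) ℂ) + ((g⁻¹ : SU2) : Matrix (Fin 2) (Fin 2) ℂ) =
      ((((E'⁻¹ : SU2) : Matrix (Fin 2) (Fin 2) ℂ) - 1) * ((((E⁻¹ : SU2)) : Matrix (Fin 2) (Fin 2) ℂ) - 1)) *
        ((g⁻¹ : SU2) : Matrix (Fin 2) (Fin 2) ℂ) := by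
    simp only [mul_inv_rev, Submonoid.coe_mul]; noncomm_ring
  rw [e, ← GaugeGroup.dist1_inv E, ← GaugeGroup.dist1_inv E', dist1_eq_norm_coe_sub_one, dist1_eq_norm_coe_sub_one]
  calc ‖((((E'⁻¹ : SU2) : Matrix (Fin 2) (Fin 2) ℂ) - 1) * ((((E⁻¹ : SU2)) : Matrix (Fin 2) (Fin 2) ℂ) - 1)) *
        ((g⁻¹ : SU2) : Matrix (Fin 2) (Fin 2) ℂ)‖
      ≤ (‖((E'⁻¹ : SU2) : Matrix (Fin 2) (Fin 2) ℂ) - 1‖ * ‖(((E⁻¹ : SU2)) : Matrix (Fin 2) (Fin 2) ℂ) - 1‖) *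
          ‖((g⁻¹ : SU2) : Matrix (Fin 2) (Fin 2) ℂ)‖ :=
        (norm_mul_le _ _).trans (mul_le_mul_of_nonneg_right (norm_mul_le _ _) (norm_nonneg _))
    _ ≤ (‖((E'⁻¹ : SU2) : Matrix (Fin 2) (Fin 2) ℂ) - 1‖ * ‖(((E⁻¹ : SU2)) : Matrix (Fin 2) (Fin 2) ℂ) - 1‖) * 1 :=
        mul_le_mul_of_nonneg_left (norm_coe_le_one _) (mul_nonneg (norm_nonneg _) (norm_nonneg _))
    _ = _ := by ring

/-- ★ THE PROFILE OF ONE LETTER POSITION under the clause's three one-bond moves (`U → V` at `b` by `E`; `U → W`, `V → Z` at `b′` by `E′`),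
for any letter map `φ` (`g ↦ ↑g` or `g ↦ ↑g⁻¹`) with the four bounds above: norms `≤ 1`; first differences `≤ dist1 E` along the `b`-move iff the
position's bond `e` is `b` (else `0`), `≤ dist1 E′` along the `b′`-move iff `e = b′`; second difference `≤ dist1 E·dist1 E′` iff `e = b = b′`. [folklore] -/
theorem letterProfile {φ : SU2 → Matrix (Fin 2) (Fin 2) ℂ}
    (hφn : ∀ g, ‖φ g‖ ≤ 1) (hφ1 : ∀ g E, ‖φ (g * E) - φ g‖ ≤ dist1 E)
    (hφ2 : ∀ g E E', ‖φ (g * E * E') - φ (g * E')‖ ≤ dist1 E)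
    (hφ3 : ∀ g E E', ‖φ (g * E * E') - φ (g * E) - φ (g * E') + φ g‖ ≤ dist1 E * dist1 E')
    [DecidableEq (PBond P j)] {U V W Z : GaugeField P j SU2} {b b' : PBond P j} {E E' : SU2} (e : PBond P j)
    (hV : ∀ e, e ≠ b → V e = U e) (hVb : V b = U b * E) (hW : ∀ e, e ≠ b' → W e = U e) (hWb : W b' = U b' * E')
    (hZ : ∀ e, e ≠ b' → Z e = V e) (hZb : Z b' = V b' * E') :
    ‖φ (U e)‖ ≤ 1 ∧ ‖φ (V e)‖ ≤ 1 ∧ ‖φ (W e)‖ ≤ 1 ∧ ‖φ (Z e)‖ ≤ 1 ∧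
    ‖φ (V e) - φ (U e)‖ ≤ (if e = b then dist1 E else 0) ∧ ‖φ (Z e) - φ (W e)‖ ≤ (if e = b then dist1 E else 0) ∧
    ‖φ (W e) - φ (U e)‖ ≤ (if e = b' then dist1 E' else 0) ∧ ‖φ (Z e) - φ (V e)‖ ≤ (if e = b' then dist1 E' else 0) ∧
    ‖φ (Z e) - φ (V e) - φ (W e) + φ (U e)‖ ≤ (if e = b ∧ e = b' then dist1 E * dist1 E' else 0) := by
  have hvu : ‖φ (V e) - φ (U e)‖ ≤ (if e = b then dist1 E else 0) := by
    by_cases h : e = b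
    · subst h; rw [if_pos rfl, hVb]; exact hφ1 _ _
    · rw [if_neg h, hV e h, sub_self, norm_zero]
  refine ⟨hφn _, hφn _, hφn _, hφn _, hvu, ?_, ?_, ?_, ?_⟩
  · by_cases h' : e = b'
    · subst h'
      rw [hZb, hWb]
      by_cases h : e = b
      · subst h; rw [if_pos rfl, hVb]; exact hφ2 _ _ _
      · rw [if_neg h, hV e h, sub_self, norm_zero]
    · rw [hZ e h', hW e h']; exact hvu
  · by_cases h' : e = b'
    · subst h'; rw [if_pos rfl, hWb]; exact hφ1 _ _
    · rw [if_neg h', hW e h', sub_self, norm_zero]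
  · by_cases h' : e = b'
    · subst h'; rw [if_pos rfl, hZb]; exact hφ1 _ _
    · rw [if_neg h', hZ e h', sub_self, norm_zero]
  · by_cases h' : e = b'
    · subst h'
      rw [hZb, hWb]
      by_cases h : e = b
      · subst h; rw [if_pos ⟨rfl, rfl⟩, hVb]; exact hφ3 _ _ _
      · rw [if_neg (fun hh => h hh.1), hV e h]
        have : φ (U e * E') - φ (U e) - φ (U e * E') + φ (U e) = 0 := by abel
        rw [this, norm_zero]
    · rw [if_neg (fun hh => h' hh.2), hZ e h', hW e h']
      have : φ (V e) - φ (V e) - φ (U e) + φ (U e) = 0 := by abel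
      rw [this, norm_zero]

/-- SUPPORT BOOKKEEPING for the four-letter word: if the `b`-move is carried by at most one of four pairwise distinct positions
`e₀ … e₃` (size `d`) and the `b′`-move likewise (size `d′`), the bound of `word4_secondDiff_le` collapses to `𝟙[b, b′ ∈ {eₖ}]·d·d′`. [folklore] -/
theorem support_bookkeeping {ι : Type*} [DecidableEq ι] {e₀ e₁ e₂ e₃ b b' : ι} {d d' : ℝ}
    (h01 : e₀ ≠ e₁) (h02 : e₀ ≠ e₂) (h03 : e₀ ≠ e₃) (h12 : e₁ ≠ e₂) (h13 : e₁ ≠ e₃) (h23 : e₂ ≠ e₃) :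
    ((if e₀ = b ∧ e₀ = b' then d * d' else 0) + (if e₁ = b ∧ e₁ = b' then d * d' else 0) +
        (if e₂ = b ∧ e₂ = b' then d * d' else 0) + (if e₃ = b ∧ e₃ = b' then d * d' else 0)) +
      ((if e₀ = b then d else 0) * ((if e₁ = b' then d' else 0) + (if e₂ = b' then d' else 0) + (if e₃ = b' then d' else 0)) +
        (if e₁ = b then d else 0) * ((if e₂ = b' then d' else 0) + (if e₃ = b' then d' else 0)) +
        (if e₂ = b then d else 0) * (if e₃ = b' then d' else 0)) +
      ((if e₀ = b' then d' else 0) * ((if e₁ = b then d else 0) + (if e₂ = b then d else 0) + (if e₃ = b then d else 0)) +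
        (if e₁ = b' then d' else 0) * ((if e₂ = b then d else 0) + (if e₃ = b then d else 0)) +
        (if e₂ = b' then d' else 0) * (if e₃ = b then d else 0)) ≤
    (if (b = e₀ ∨ b = e₁ ∨ b = e₂ ∨ b = e₃) ∧ (b' = e₀ ∨ b' = e₁ ∨ b' = e₂ ∨ b' = e₃) then (1:ℝ) else 0) * (d * d') := by
  by_cases hb : b = e₀ ∨ b = e₁ ∨ b = e₂ ∨ b = e₃
  · by_cases hb' : b' = e₀ ∨ b' = e₁ ∨ b' = e₂ ∨ b' = e₃
    · simp only [hb, hb', and_self, if_true, one_mul]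
      rcases hb with rfl | rfl | rfl | rfl <;> rcases hb' with rfl | rfl | rfl | rfl <;>
        simp [h01, h02, h03, h12, h13, h23, h01.symm, h02.symm, h03.symm, h12.symm, h13.symm, h23.symm, mul_comm]
    · simp only [hb', and_false, if_false, zero_mul]
      simp only [not_or] at hb'
      obtain ⟨h0, h1, h2, h3⟩ := hb'
      simp [Ne.symm h0, Ne.symm h1, Ne.symm h2, Ne.symm h3]
  · simp only [hb, false_and, if_false, zero_mul]
    simp only [not_or] at hb
    obtain ⟨h0, h1, h2, h3⟩ := hb
    simp [Ne.symm h0, Ne.symm h1, Ne.symm h2, Ne.symm h3]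

/-- The holonomy `U(∂p)` read as a matrix word in its four letters. [folklore] -/
theorem coe_plaqHol_eq (U : GaugeField P j SU2) (p : Plaq P j) :
    ((GaugeField.plaqHol U p : SU2) : Matrix (Fin 2) (Fin 2) ℂ) =
      (U (bond₁ p) : Matrix (Fin 2) (Fin 2) ℂ) * (U (bond₂ p) : Matrix (Fin 2) (Fin 2) ℂ) *
        (((U (bond₃ p))⁻¹ : SU2) : Matrix (Fin 2) (Fin 2) ℂ) * (((U (bond₄ p))⁻¹ : SU2) : Matrix (Fin 2) (Fin 2) ℂ) := by
  rw [plaqHol_eq_letters]; simp only [Submonoid.coe_mul]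

/-- ★★ THE PER-PLAQUETTE BILINEAR BOUND: under the clause's three one-bond moves,
`|reTr Z(∂p) − reTr V(∂p) − reTr W(∂p) + reTr U(∂p)| ≤ 𝟙[b ∈ ∂p ∧ b′ ∈ ∂p]·dist1 E·dist1 E′`. [folklore] -/
theorem abs_secondDiff_reTr_plaqHol_le [DecidableEq (PBond P j)] (p : Plaq P j)
    {U V W Z : GaugeField P j SU2} {b b' : PBond P j} {E E' : SU2}
    (hV : ∀ e, e ≠ b → V e = U e) (hVb : V b = U b * E) (hW : ∀ e, e ≠ b' → W e = U e) (hWb : W b' = U b' * E')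
    (hZ : ∀ e, e ≠ b' → Z e = V e) (hZb : Z b' = V b' * E') :
    |reTr (GaugeField.plaqHol Z p) - reTr (GaugeField.plaqHol V p) - reTr (GaugeField.plaqHol W p) +
        reTr (GaugeField.plaqHol U p)| ≤
      (if IsLetter b p ∧ IsLetter b' p then (1:ℝ) else 0) * (dist1 E * dist1 E') := by
  have h₁ := letterProfile (φ := fun g : SU2 => (g : Matrix (Fin 2) (Fin 2) ℂ)) norm_coe_le_one coe_move_le coe_move_mid_le
    coe_move_two_le (bond₁ p) hV hVb hW hWb hZ hZb
  have h₂ := letterProfile (φ := fun g : SU2 => (g : Matrix (Fin 2) (Fin 2) ℂ)) norm_coe_le_one coe_move_le coe_move_mid_le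
    coe_move_two_le (bond₂ p) hV hVb hW hWb hZ hZb
  have h₃ := letterProfile (φ := fun g : SU2 => ((g⁻¹ : SU2) : Matrix (Fin 2) (Fin 2) ℂ)) (fun g => norm_coe_le_one _)
    inv_move_le inv_move_mid_le inv_move_two_le (bond₃ p) hV hVb hW hWb hZ hZb
  have h₄ := letterProfile (φ := fun g : SU2 => ((g⁻¹ : SU2) : Matrix (Fin 2) (Fin 2) ℂ)) (fun g => norm_coe_le_one _)
    inv_move_le inv_move_mid_le inv_move_two_le (bond₄ p) hV hVb hW hWb hZ hZb
  have key := word4_secondDiff_le h₁ h₂ h₃ h₄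
  refine (abs_secondDiff_reTr_le_norm _ _ _ _).trans ?_
  rw [coe_plaqHol_eq, coe_plaqHol_eq, coe_plaqHol_eq, coe_plaqHol_eq]
  obtain ⟨n12, n13, n14, n23, n24, n34⟩ := letters_pairwise_ne p
  exact key.trans (support_bookkeeping n12 n13 n14 n23 n24 n34)

end Letters

end Summit.QuantumFields.YangMills.Theorems.OrganTangentMarginalHClauseLetters

end
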